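import Summits.QuantumFields.YangMills.Theorems.SwapVirialDeficitSectorLaplaceTipCoreReduction
import Summits.QuantumFields.YangMills.Theorems.SwapVirialDeficitSectorLaplaceEndShellLetters
import Summits.QuantumFields.YangMills.Theorems.SwapVirialDeficitSectorLaplaceBulkFibredPlane
import Mathlib.Analysis.SpecialFunctions.ImproperIntegrals
import HarnessLib

/-!
# Route `SwapVirialDeficit` (YangMills): THE TIP WINDOW AS A `δ`-INTEGRAL OF HUB INTEGRALS, AND THE BULK LAW AT THE HUB `hubAt δ 1`
# (cell ym-idea-1, skeleton ➎, `stub_core_tip`: the two READINGS every version of T-N6b `tip_mid_le_shell` needs (w2 g60 memo3 §1 ∕ LEAD g99 23:11Z: TIP-MID vs SHELL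
# is a SAME-currency comparison through ✓`bulk_fibred_plane` on both sides); free-hands support of ⟨stmt-QuantumFields-24197⟩ `SwapVirialDeficit.SwapGluedStiffness`)

The left side `hT` of ✓`stub_core_tip_of_shellBound` is the window integral `coneConst·π·∫_{{(1+δ²)⁻¹ < τ}} e^{−bF̂(hubAt δ 1, ε, η)} dμ_B(δ,η)`; its right side is the bulk hub mass,
floored in `δ` letters by ✓`mbMain_ge_of_subset`.  This file puts the LEFT side in the same letters:
* §1 `hubIntegral_eq_hubCot` (`I(a) = I(hubAt δ 1)`, `δ = re a/‖im a‖`), `measurable_hubIntegral_hubAt`, `hubAt_mem_hubBulk_iff` (`hubAt δ 1 ∈ HubBulk ψ₀ ↔ ψ₀ ≤ 4δ²/(1+δ²)² ∧ ψ₀ ≤ (1+δ²)⁻¹`);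
* §2 ★★ `setIntegral_tipHub_hubIntegral_eq_hubCot` — `∫_{TipHub τ} I(a) dcone = coneConst·π·∫_{{(1+δ²)⁻¹ < τ}} ((1+δ²)⁻¹)²·I(hubAt δ 1) dδ` (pattern of
  ✓`setIntegral_planeMass_hubBulk_eq_hubCot`), ★★ `tipWindow_eq_integral_hubIntegral` — THE LEFT SIDE OF `hT` IS `coneConst·π·∫_{{(1+δ²)⁻¹<τ}} ((1+δ²)⁻¹)²·I(hubAt δ 1, ε; b) dδ`
  (✓`setIntegral_tipHub_exp_eq_hubCot` ∘ ✓`setIntegral_tipHub_exp_eq_cone_hubIntegral`), `integrable_sqInv_mul_hubIntegral_hubAt` (the `δ`-integrand is integrable on `ℝ`,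
  dominated by `(1+δ²)⁻¹·∫ρ`) — so the window splits freely into TIP-MID ∕ TIP-CORE ∕ `δ ≶ 0` on the `δ` side;
* §3 ★★ `hubIntegral_hubAt_two_sided` — ✓`bulk_fibred_plane` at the hub `hubAt δ 1` with ANY cut `ψ₀ ≤ min(4δ²/(1+δ²)², (1+δ²)⁻¹)`:
  `|I(hubAt δ 1, ε; b) − (2π/b)^α·∫𝔪(hubAt δ 1, ε, ·)| ≤ K L^k ψ₀^{−k} b^{−1/2}·(2π/b)^α∫𝔪 + (∫ρ)·e^{−b(ψ₀/(KL^k))^k}` above `b ≥ (KL^kψ₀^{−k})²` — the law reaches DOWN THE TIP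
  to hub angle `h_b` (cut `ψ₀ ≍ δ⁻²` as long as the threshold holds), which is memo3 §1's observation.

HONEST LABEL: measure bookkeeping ∕ a corollary; the sandwich (✓`mbDensity_ge_softCeil` shell side; `mbDensity_le_floorDet` tip side, w2 g61), the tip-core, corner and ends,
and the assembly of `hT` remain; `stub_core_tip`, ⟨24197⟩ ∕ ⟨24194⟩ OPEN; own crux ⟨22884⟩ `LargeFieldMassRefinementTail` OPEN (blocked-on ⟨19935⟩); the Yang–Mills mass gap is
NOT proved; no summit is proved by a line.  THEOREMS ONLY (0 `def`, 0 `sorry`), standard axioms, no instances.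
Width seat ym-line-sfw-p2-w3 g68 (cell ym-idea-1, free hands), `--supports stmt-QuantumFields-24197`.  References: [cite: Luscher1983, §2]; [folklore].
-/

set_option autoImplicit false
set_option synthInstance.maxSize 1024

noncomputable section

open MeasureTheory Quaternion Set
open scoped Quaternion BigOperators ENNReal
open Literature.MathematicalPhysics.QuantumLattice
open Literature.MathematicalPhysics.QuantumFieldTheory hiding SU2
open Summit.QuantumFields.YangMills.Theorems.SwapTwistDeficit.ToronLog

namespace Summit.QuantumFields.YangMills.Theorems.SwapVirialDeficit.SectorLaplace

open Summit.QuantumFields.YangMills.Theorems.FemtoTransferGap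
open Summit.QuantumFields.YangMills.Theorems.FemtoTransferGap.TT
open Summit.QuantumFields.YangMills.Theorems.VirialFluxGap.RingDeficit
open Summit.QuantumFields.YangMills.Theorems.SwapVirialDeficit.SwapRing
open Summit.QuantumFields.YangMills.Theorems.SwapVirialDeficit.BlowUpRing

variable {L : ℕ} [NeZero L]

/-! ## §1 The hub integral in the letter `δ` -/

/-- `I(a, ε; b) = I(hubAt δ 1, ε; b)`, `δ = re a/‖im a‖` (`im a ≠ 0`; ✓`gnoDeficit_eq_hubCot`). [folklore] -/
theorem hubIntegral_eq_hubCot {a : ℍ} (him : a.im ≠ 0) (ε : GnoSign L) (b : ℝ) :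
    hubIntegral (L := L) a ε b = hubIntegral (hubAt (a.re / ‖a.im‖) 1) ε b := by
  unfold hubIntegral
  simp_rw [gnoDeficit_eq_hubCot z₀ (fun _ => 1) him]

/-- `δ ↦ I(hubAt δ 1, ε; b)` is measurable (✓`stronglyMeasurable_hubIntegral` ∘ ✓`measurable_hubAt`). [folklore] -/
theorem measurable_hubIntegral_hubAt (ε : GnoSign L) (b : ℝ) : Measurable fun δ : ℝ => hubIntegral (L := L) (hubAt δ 1) ε b :=
  (stronglyMeasurable_hubIntegral (L := L) ε b).measurable.comp (measurable_hubAt.comp (measurable_id.prodMk measurable_const))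

omit [NeZero L] in
/-- `hubAt δ 1 ∈ HubBulk ψ₀ ↔ ψ₀ ≤ 4δ²/(1+δ²)² ∧ ψ₀ ≤ (1+δ²)⁻¹` (✓`mem_hubBulk_iff_cot`, `re/‖im‖ = δ`). [folklore] -/
theorem hubAt_mem_hubBulk_iff (δ ψ₀ : ℝ) :
    hubAt δ 1 ∈ HubBulk ψ₀ ↔ ψ₀ ≤ 4 * δ ^ 2 / (1 + δ ^ 2) ^ 2 ∧ ψ₀ ≤ (1 + δ ^ 2)⁻¹ := by
  have h := mem_hubBulk_iff_cot (hubAt_one_im_ne_zero δ) ψ₀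
  have hre : (hubAt δ 1).re = δ := rfl
  rw [norm_im_hubAt_one, hre, div_one] at h
  exact h

/-- `0 ≤ I(hubAt δ 1) ≤ ∫ρ` for `b ≥ 0`. [folklore] -/
theorem hubIntegral_hubAt_le_mass {b : ℝ} (hb : 0 ≤ b) (δ : ℝ) (ε : GnoSign L) :
    0 ≤ hubIntegral (L := L) (hubAt δ 1) ε b ∧ hubIntegral (L := L) (hubAt δ 1) ε b ≤ ∫ η : GnoCoord L, gnoDensity η :=
  ⟨hubIntegral_nonneg _ ε b, hubIntegral_le_mass hb _ ε⟩

/-! ## §2 The tip window as a `δ`-integral of hub integrals -/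

/-- ★★ **THE TIP HUB MASS IN THE LETTER `δ`** (`ℝ≥0∞` form):
`∫⁻_{TipHub τ} ofReal(I(a)) dcone = coneConst·π·∫⁻_{{(1+δ²)⁻¹ < τ}} ofReal(I(hubAt δ 1))·ofReal(((1+δ²)⁻¹)²) dδ` (✓`lintegral_coneMeasure_hubCot`). [folklore] -/
theorem lintegral_tipHub_hubIntegral_eq_hubCot (ε : GnoSign L) (τ b : ℝ) :
    ∫⁻ a in TipHub τ, ENNReal.ofReal (hubIntegral (L := L) a ε b) ∂coneMeasure =
      ENNReal.ofReal (coneConst * Real.pi) *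
        ∫⁻ δ in {δ : ℝ | (1 + δ ^ 2)⁻¹ < τ}, ENNReal.ofReal (hubIntegral (L := L) (hubAt δ 1) ε b) * ENNReal.ofReal (((1 + δ ^ 2)⁻¹) ^ 2) := by
  have hWm : MeasurableSet {δ : ℝ | (1 + δ ^ 2)⁻¹ < τ} :=
    measurableSet_lt ((measurable_const.add (measurable_id.pow_const 2)).inv) measurable_const
  have hGm : Measurable ({δ : ℝ | (1 + δ ^ 2)⁻¹ < τ}.indicator fun δ : ℝ => ENNReal.ofReal (hubIntegral (L := L) (hubAt δ 1) ε b)) :=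
    (measurable_hubIntegral_hubAt (L := L) ε b).ennreal_ofReal.indicator hWm
  -- the hub integrand is a.e. a function of `δ`
  have hae : (fun a : ℍ => (TipHub τ).indicator (fun a => ENNReal.ofReal (hubIntegral (L := L) a ε b)) a) =ᵐ[coneMeasure]
      fun a : ℍ => ({δ : ℝ | (1 + δ ^ 2)⁻¹ < τ}.indicator fun δ : ℝ => ENNReal.ofReal (hubIntegral (L := L) (hubAt δ 1) ε b)) (a.re / ‖a.im‖) := by
    filter_upwards [ae_re_ne_zero_im_ne_zero_coneMeasure] with a ha
    have hI := hubIntegral_eq_hubCot (L := L) ha.2 ε b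
    have hmem : a ∈ TipHub τ ↔ a.re / ‖a.im‖ ∈ {δ : ℝ | (1 + δ ^ 2)⁻¹ < τ} := by
      simp only [TipHub, mem_setOf_eq, hubS2_eq_cot ha.2]
    by_cases hb : a ∈ TipHub τ
    · rw [indicator_of_mem hb, indicator_of_mem (hmem.1 hb), hI]
    · rw [indicator_of_notMem hb, indicator_of_notMem (fun h => hb (hmem.2 h))]
  rw [← lintegral_indicator (measurableSet_tipHub τ), lintegral_congr_ae hae, lintegral_coneMeasure_hubCot _ hGm, ← lintegral_indicator hWm]
  congr 1
  refine lintegral_congr fun δ => ?_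
  by_cases hδ : δ ∈ {δ : ℝ | (1 + δ ^ 2)⁻¹ < τ}
  · rw [indicator_of_mem hδ, indicator_of_mem hδ]
  · rw [indicator_of_notMem hδ, indicator_of_notMem hδ, zero_mul]

/-- ★★ **THE TIP HUB MASS IN THE LETTER `δ`** (Bochner form):
`∫_{TipHub τ} I(a, ε; b) dcone = coneConst·π·∫_{{(1+δ²)⁻¹ < τ}} ((1+δ²)⁻¹)²·I(hubAt δ 1, ε; b) dδ`. [folklore] -/
theorem setIntegral_tipHub_hubIntegral_eq_hubCot (ε : GnoSign L) (τ b : ℝ) :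
    ∫ a in TipHub τ, hubIntegral (L := L) a ε b ∂coneMeasure =
      coneConst * Real.pi * ∫ δ in {δ : ℝ | (1 + δ ^ 2)⁻¹ < τ}, ((1 + δ ^ 2)⁻¹) ^ 2 * hubIntegral (L := L) (hubAt δ 1) ε b := by
  have hI0 : ∀ a : ℍ, 0 ≤ hubIntegral (L := L) a ε b := fun a => hubIntegral_nonneg a ε b
  have hm2 : Measurable fun δ : ℝ => ((1 + δ ^ 2)⁻¹) ^ 2 * hubIntegral (L := L) (hubAt δ 1) ε b :=
    (((measurable_const.add (measurable_id.pow_const 2)).inv).pow_const 2).mul (measurable_hubIntegral_hubAt ε b)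
  rw [integral_eq_lintegral_of_nonneg_ae (Filter.Eventually.of_forall fun a => hI0 a) (stronglyMeasurable_hubIntegral (L := L) ε b).aestronglyMeasurable.restrict,
    integral_eq_lintegral_of_nonneg_ae (Filter.Eventually.of_forall fun δ => mul_nonneg (by positivity) (hI0 _)) hm2.aestronglyMeasurable.restrict,
    lintegral_tipHub_hubIntegral_eq_hubCot ε τ b, ENNReal.toReal_mul, ENNReal.toReal_ofReal (mul_pos coneConst_pos Real.pi_pos).le]
  congr 2
  refine lintegral_congr fun δ => ?_
  rw [← ENNReal.ofReal_mul (hI0 _), mul_comm]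

/-- ★★ **THE LEFT SIDE OF `hT` IN THE LETTER `δ`**: for `b ≥ 0`,
`coneConst·π·∫_{{(1+δ²)⁻¹ < τ}} e^{−bF̂(hubAt δ 1, ε, η)} dμ_B(δ,η) = coneConst·π·∫_{{(1+δ²)⁻¹ < τ}} ((1+δ²)⁻¹)²·I(hubAt δ 1, ε; b) dδ` — the window integral of
✓`stub_core_tip_of_shellBound` ∕ ✓`stub_core_tip_of_tipBound` as a `δ`-integral of hub integrals (✓`setIntegral_tipHub_exp_eq_hubCot`, ✓`setIntegral_tipHub_exp_eq_cone_hubIntegral`).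
[folklore] -/
theorem tipWindow_eq_integral_hubIntegral (ε : GnoSign L) (τ : ℝ) {b : ℝ} (hb : 0 ≤ b) :
    coneConst * Real.pi *
        ∫ p in {p : ℝ × GnoCoord L | (1 + p.1 ^ 2)⁻¹ < τ},
          Real.exp (-(b * gnoDeficit z₀ (fun _ => 1) (hubAt p.1 1) ε p.2))
          ∂((volume : Measure (ℝ × GnoCoord L)).withDensity fun p => ENNReal.ofReal (((1 + p.1 ^ 2)⁻¹) ^ 2 * gnoDensity p.2)) =
      coneConst * Real.pi * ∫ δ in {δ : ℝ | (1 + δ ^ 2)⁻¹ < τ}, ((1 + δ ^ 2)⁻¹) ^ 2 * hubIntegral (L := L) (hubAt δ 1) ε b := by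
  rw [← setIntegral_tipHub_exp_eq_hubCot z₀ (fun _ => (1 : SU2)) ε τ b, setIntegral_tipHub_exp_eq_cone_hubIntegral ε τ hb,
    setIntegral_tipHub_hubIntegral_eq_hubCot ε τ b]

/-- The `δ`-integrand `((1+δ²)⁻¹)²·I(hubAt δ 1, ε; b)` is integrable on `ℝ` for `b ≥ 0` (dominated by `(1+δ²)⁻¹·∫ρ`, ✓`integrable_inv_one_add_sq`) — so the tip
window splits freely on the `δ` side (mid ∕ core, `δ ≶ 0`). [folklore] -/
theorem integrable_sqInv_mul_hubIntegral_hubAt (ε : GnoSign L) {b : ℝ} (hb : 0 ≤ b) :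
    Integrable fun δ : ℝ => ((1 + δ ^ 2)⁻¹) ^ 2 * hubIntegral (L := L) (hubAt δ 1) ε b := by
  have hm2 : Measurable fun δ : ℝ => ((1 + δ ^ 2)⁻¹) ^ 2 * hubIntegral (L := L) (hubAt δ 1) ε b :=
    (((measurable_const.add (measurable_id.pow_const 2)).inv).pow_const 2).mul (measurable_hubIntegral_hubAt ε b)
  refine ((integrable_inv_one_add_sq.mul_const (∫ η : GnoCoord L, gnoDensity η))).mono' hm2.aestronglyMeasurable
    (Filter.Eventually.of_forall fun δ => ?_)
  obtain ⟨h0, hM⟩ := hubIntegral_hubAt_le_mass (L := L) hb δ ε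
  have h1 : (1 + δ ^ 2)⁻¹ ≤ 1 := inv_le_one_of_one_le₀ (by nlinarith [sq_nonneg δ])
  have h1' : 0 ≤ (1 + δ ^ 2)⁻¹ := by positivity
  rw [Real.norm_eq_abs, abs_of_nonneg (mul_nonneg (by positivity) h0)]
  calc ((1 + δ ^ 2)⁻¹) ^ 2 * hubIntegral (L := L) (hubAt δ 1) ε b ≤ ((1 + δ ^ 2)⁻¹ * 1) * ∫ η : GnoCoord L, gnoDensity η := by
        rw [sq]; exact mul_le_mul (mul_le_mul_of_nonneg_left h1 h1') hM h0 (by positivity)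
    _ = (1 + δ ^ 2)⁻¹ * ∫ η : GnoCoord L, gnoDensity η := by rw [mul_one]

/-! ## §3 The bulk law at the hub `hubAt δ 1` -/

/-- ★★ **THE BULK LAW REACHES DOWN THE TIP**: with the constants `K, k` of ✓`bulk_fibred_plane`, for every cut `0 < ψ₀ ≤ 1` with `ψ₀ ≤ 4δ²/(1+δ²)²`, `ψ₀ ≤ (1+δ²)⁻¹`
(i.e. `hubAt δ 1 ∈ HubBulk ψ₀`), every `b ≥ (K L^k ψ₀^{−k})²` and good `ε`, the hub integral at `hubAt δ 1` is two-sidedly the Morse–Bott main term: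
`I ≤ (1 + E)·(2π/b)^α∫𝔪 + T` and `(1 − E)·(2π/b)^α∫𝔪 − T ≤ I`, `E = K L^k ψ₀^{−k} b^{−1/2}`, `T = (∫ρ)·e^{−b(ψ₀/(KL^k))^k}`. [cite: Luscher1983, §2] -/
theorem hubIntegral_hubAt_two_sided : ∃ K : ℝ, 0 < K ∧ ∃ k : ℕ, ∀ (L : ℕ) [NeZero L] (ψ₀ b : ℝ), 0 < ψ₀ → ψ₀ ≤ 1 →
    (K * (L : ℝ) ^ k * (1 / ψ₀) ^ k) ^ 2 ≤ b → ∀ δ : ℝ, ψ₀ ≤ 4 * δ ^ 2 / (1 + δ ^ 2) ^ 2 → ψ₀ ≤ (1 + δ ^ 2)⁻¹ → ∀ ε : GnoSign L, GoodSign ε →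
      hubIntegral (L := L) (hubAt δ 1) ε b ≤
          (1 + K * (L : ℝ) ^ k * (1 / ψ₀) ^ k * b ^ (-(1 / 2 : ℝ))) * ((2 * Real.pi / b) ^ alpha L * ∫ p : ℝ × ℝ, mbDensity (L := L) (hubAt δ 1) ε p) +
            (∫ η : GnoCoord L, gnoDensity η) * Real.exp (-(b * (ψ₀ / (K * (L : ℝ) ^ k)) ^ k)) ∧
        (1 - K * (L : ℝ) ^ k * (1 / ψ₀) ^ k * b ^ (-(1 / 2 : ℝ))) * ((2 * Real.pi / b) ^ alpha L * ∫ p : ℝ × ℝ, mbDensity (L := L) (hubAt δ 1) ε p) -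
            (∫ η : GnoCoord L, gnoDensity η) * Real.exp (-(b * (ψ₀ / (K * (L : ℝ) ^ k)) ^ k)) ≤
          hubIntegral (L := L) (hubAt δ 1) ε b := by
  obtain ⟨K, hK, k, hlaw⟩ := bulk_fibred_plane
  refine ⟨K, hK, k, fun L _ ψ₀ b hψ₀ hψ₁ hb δ h1 h2 ε hε => ?_⟩
  have hmem : hubAt δ 1 ∈ HubBulk ψ₀ := (hubAt_mem_hubBulk_iff δ ψ₀).2 ⟨h1, h2⟩
  have h := hlaw L ψ₀ b hψ₀ hψ₁ hb (hubAt δ 1) hmem ε hε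
  have hI : (∫ η : GnoCoord L, Real.exp (-(b * gnoDeficit z₀ (fun _ => 1) (hubAt δ 1) ε η)) * gnoDensity η) = hubIntegral (L := L) (hubAt δ 1) ε b := rfl
  rw [hI] at h
  obtain ⟨hlo, hhi⟩ := abs_sub_le_iff.1 h
  constructor
  · linarith
  · linarith

end Summit.QuantumFields.YangMills.Theorems.SwapVirialDeficit.SectorLaplace

end
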